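import Mathlib.MeasureTheory.Measure.Portmanteau
import Mathlib.Topology.TietzeExtension
import HarnessLib

/-!
# Weak limits through maps continuous on large closed sets

Topic `Literature/Probability/RandomPlanarGeometry` (family `crit-ising`); theorems only, no
definition and no named fact. Pure measure theory (Mathlib's portmanteau and Tietze theorems).

This is the measure-theoretic assembly step of A. Kemppainen, S. Smirnov, *Random curves,
scaling limits and Loewner evolutions*, Ann. Probab. 45 (2017), proof of Thm. 1.5 (§3.5,
arXiv:1212.6215 p. 18): having chosen events `E = ⋂ E_k` of probability `≥ 1 - ε` uniformly over
the family of laws, on (the closure of) which the curves are described by the Loewner evolution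
and the map "curve ↦ driving function" is continuous (the main lemma A.5), the conclusions
"the limit law is supported on Loewner-describable curves" and "the driving processes converge in
law" follow by the portmanteau theorem. Abstractly:

* `measure_compl_le_of_tendsto_of_isClosed` — if `P_n → μ` weakly and eventually
  `P_n(Fᶜ) ≤ ε` for a closed `F`, then `μ(Fᶜ) ≤ ε` (portmanteau for the closed set `F`);
* `ae_mem_iUnion_of_tendsto` — with closed `F_k` and `P_n(F_kᶜ) ≤ ε_k → 0`, `μ`-a.e. point
  lies in `⋃ F_k`;
* **`tendsto_map_of_continuousOn_closed`** — if moreover `f : X → Y` is measurable and continuous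
  on each `F_k`, then the image laws converge: `f_* P_n → f_* μ` weakly (test against
  `g : Y →ᵇ ℝ`; Tietze-extend `g ∘ f|_{F_k}` to `X`; the error is `≤ 4 ‖g‖ ε_k`).

## References

* A. Kemppainen, S. Smirnov, Ann. Probab. 45 (2017), §3.5 (proof of Thm. 1.5) and App. A
  Lemma A.5. [KemppainenSmirnov2017]
* P. Billingsley, *Convergence of Probability Measures*, 2nd ed. (1999), Thm. 2.1
  (portmanteau), Thm. 2.7 (mapping theorem). [folklore]
-/

noncomputable section

open Set Filter Topology MeasureTheory BoundedContinuousFunction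
open scoped ENNReal NNReal

namespace Literature.Probability.RandomPlanarGeometry

variable {X Y : Type*} [TopologicalSpace X] [MeasurableSpace X] [OpensMeasurableSpace X]
  [HasOuterApproxClosed X] {P : ℕ → ProbabilityMeasure X} {μ : ProbabilityMeasure X}

/-- **The limit law charges the complement of a good closed set as little as the approximants**:
if `P_n → μ` weakly, `F` is closed and eventually `P_n(Fᶜ) ≤ ε`, then `μ(Fᶜ) ≤ ε`
(portmanteau: `limsup P_n(F) ≤ μ(F)`). [cite: KemppainenSmirnov2017, §3.5] -/
theorem measure_compl_le_of_tendsto_of_isClosed (hP : Tendsto P atTop (𝓝 μ)) {F : Set X}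
    (hF : IsClosed F) {ε : ℝ≥0∞} (h : ∀ᶠ n in atTop, (P n : Measure X) Fᶜ ≤ ε) :
    (μ : Measure X) Fᶜ ≤ ε := by
  have hport := ProbabilityMeasure.limsup_measure_closed_le_of_tendsto hP hF
  have hlow : ∀ᶠ n in atTop, 1 - ε ≤ (P n : Measure X) F := by
    filter_upwards [h] with n hn
    have h1 : (P n : Measure X) F = 1 - (P n : Measure X) Fᶜ := by
      have := prob_compl_eq_one_sub (μ := (P n : Measure X)) hF.measurableSet
      rw [this, ENNReal.sub_sub_cancel ENNReal.one_ne_top prob_le_one]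
    rw [h1]
    exact tsub_le_tsub_left hn 1
  have h2 : 1 - ε ≤ (μ : Measure X) F :=
    (le_limsup_of_frequently_le hlow.frequently).trans hport
  rw [prob_compl_eq_one_sub hF.measurableSet]
  refine tsub_le_iff_right.2 ?_
  calc (1 : ℝ≥0∞) ≤ (1 - ε) + ε := le_tsub_add
    _ ≤ (μ : Measure X) F + ε := add_le_add h2 le_rfl
    _ = ε + (μ : Measure X) F := add_comm _ _

/-- **`μ`-almost every point lies in some good set**: if `P_n → μ` weakly and the closed sets
`F_k` have eventually `P_n(F_kᶜ) ≤ ε_k` with `ε_k → 0`, then `μ (⋃ F_k)ᶜ = 0`.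
[cite: KemppainenSmirnov2017, §3.5] -/
theorem ae_mem_iUnion_of_tendsto (hP : Tendsto P atTop (𝓝 μ)) {F : ℕ → Set X}
    (hF : ∀ k, IsClosed (F k)) {ε : ℕ → ℝ≥0∞} (h : ∀ k, ∀ᶠ n in atTop, (P n : Measure X) (F k)ᶜ ≤ ε k)
    (hε : Tendsto ε atTop (𝓝 0)) : ∀ᵐ x ∂(μ : Measure X), ∃ k, x ∈ F k := by
  have hk : ∀ k, (μ : Measure X) (⋃ k, F k)ᶜ ≤ ε k := fun k ↦
    (measure_mono (compl_subset_compl.2 (subset_iUnion F k))).trans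
      (measure_compl_le_of_tendsto_of_isClosed hP (hF k) (h k))
  have h0 : (μ : Measure X) (⋃ k, F k)ᶜ = 0 :=
    le_antisymm (ge_of_tendsto' hε hk) bot_le
  rw [ae_iff]
  refine measure_mono_null (fun x hx ↦ ?_) h0
  simp only [mem_setOf_eq, not_exists] at hx
  simpa [mem_compl_iff, mem_iUnion] using hx

variable [NormalSpace X] [TopologicalSpace Y] [MeasurableSpace Y] [OpensMeasurableSpace Y]

/-- The integral of a function vanishing on `F` and bounded by `C` is at most `C P(Fᶜ)`.
[folklore] -/
theorem norm_integral_le_of_eqOn_zero {Z : Type*} [MeasurableSpace Z] {ν : Measure Z}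
    [IsFiniteMeasure ν] {u : Z → ℝ} {F : Set Z} (hF : MeasurableSet F) (h0 : ∀ x ∈ F, u x = 0)
    {C : ℝ} (hb : ∀ x, ‖u x‖ ≤ C) : ‖∫ x, u x ∂ν‖ ≤ C * ν.real Fᶜ := by
  have h1 : ∀ x, ‖u x‖ ≤ (Fᶜ).indicator (fun _ ↦ C) x := by
    intro x
    by_cases hx : x ∈ F
    · simp [h0 x hx, indicator_of_notMem (notMem_compl_iff.2 hx)]
    · rw [indicator_of_mem (mem_compl hx)]
      exact hb x
  calc ‖∫ x, u x ∂ν‖ ≤ ∫ x, ‖u x‖ ∂ν := norm_integral_le_integral_norm _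
    _ ≤ ∫ x, (Fᶜ).indicator (fun _ ↦ C) x ∂ν := by
        refine integral_mono_of_nonneg (Eventually.of_forall fun x ↦ norm_nonneg _) ?_
          (Eventually.of_forall h1)
        exact (integrable_const C).indicator hF.compl
    _ = C * ν.real Fᶜ := by
        rw [integral_indicator hF.compl, setIntegral_const, smul_eq_mul, mul_comm]

/-- **Mapping theorem for maps continuous on large closed sets.** Let `P_n → μ` weakly on `X`
(normal, e.g. metrisable), let `F_k ⊆ X` be closed with eventually `P_n(F_kᶜ) ≤ ε_k`, `ε_k → 0`,
and let `f : X → Y` be measurable and continuous on each `F_k`. Then the image laws converge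
weakly: `f_* P_n → f_* μ`. (For `g : Y →ᵇ ℝ`, Tietze-extend `g ∘ f|_{F_k}` to `h : X →ᵇ ℝ` with
the same bound; `|∫ g∘f dν - ∫ h dν| ≤ 2‖g‖ ν(F_kᶜ)` for `ν = P_n, μ`.) Kemppainen–Smirnov use
it with `f = ` "curve ↦ driving function", continuous on the closures of their events `E`
(Lemma A.5). [cite: KemppainenSmirnov2017, §3.5 and App. A Lemma A.5] -/
theorem tendsto_map_of_continuousOn_closed (hP : Tendsto P atTop (𝓝 μ)) {F : ℕ → Set X}
    (hF : ∀ k, IsClosed (F k)) {ε : ℕ → ℝ} (hε0 : ∀ k, 0 ≤ ε k)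
    (h : ∀ k, ∀ᶠ n in atTop, (P n : Measure X) (F k)ᶜ ≤ ENNReal.ofReal (ε k))
    (hε : Tendsto ε atTop (𝓝 0)) {f : X → Y} (hf : Measurable f)
    (hcont : ∀ k, ContinuousOn f (F k)) :
    Tendsto (fun n ↦ (P n).map hf.aemeasurable) atTop (𝓝 (μ.map hf.aemeasurable)) := by
  rw [ProbabilityMeasure.tendsto_iff_forall_integral_tendsto]
  intro g
  -- reduce to integrals of `G = g ∘ f` on `X`
  have hint : ∀ ν : ProbabilityMeasure X,
      ∫ y, g y ∂((ν.map hf.aemeasurable : ProbabilityMeasure Y) : Measure Y) =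
        ∫ x, g (f x) ∂(ν : Measure X) := by
    intro ν
    rw [ProbabilityMeasure.toMeasure_map]
    exact integral_map hf.aemeasurable g.continuous.aestronglyMeasurable
  simp only [hint]
  set G : X → ℝ := fun x ↦ g (f x) with hG
  have hGm : ∀ ν : Measure X, AEStronglyMeasurable G ν := fun ν ↦
    (g.continuous.measurable.comp hf).aestronglyMeasurable
  have hGb : ∀ x, ‖G x‖ ≤ ‖g‖ := fun x ↦ g.norm_coe_le_norm (f x)
  -- Tietze extensions of `G|F_k`
  have hext : ∀ k, ∃ hk : X →ᵇ ℝ, (∀ x, ‖hk x‖ ≤ ‖g‖) ∧ ∀ x ∈ F k, hk x = G x := by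
    intro k
    have hc : Continuous ((F k).restrict G) :=
      continuousOn_iff_continuous_restrict.1 (g.continuous.comp_continuousOn (hcont k))
    set fk : (F k) →ᵇ ℝ := BoundedContinuousFunction.mkOfBound ⟨(F k).restrict G, hc⟩ (2 * ‖g‖)
      (fun x y ↦ by
        simp only [ContinuousMap.coe_mk, restrict_apply]
        exact (dist_le_norm_add_norm _ _).trans (by linarith [hGb x, hGb y])) with hfk
    have hfk_apply : ∀ x : F k, fk x = G x := fun x ↦ rfl
    have hmem : ∀ x : F k, fk x ∈ Icc (-‖g‖) ‖g‖ := fun x ↦ by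
      rw [hfk_apply]
      exact abs_le.1 ((Real.norm_eq_abs _).symm.trans_le (hGb x))
    obtain ⟨hk, hkmem, hkres⟩ := exists_forall_mem_restrict_eq_of_closed fk (hF k) hmem
      ⟨0, by simp [norm_nonneg]⟩
    refine ⟨hk, fun x ↦ ?_, fun x hx ↦ ?_⟩
    · rw [Real.norm_eq_abs]
      exact abs_le.2 (hkmem x)
    · have := congrArg (fun φ : (F k) →ᵇ ℝ ↦ φ ⟨x, hx⟩) hkres
      simpa [hfk_apply] using this
  -- integrability
  have hGi : ∀ ν : Measure X, IsFiniteMeasure ν → Integrable G ν := fun ν _ ↦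
    Integrable.of_bound (hGm ν) ‖g‖ (Eventually.of_forall hGb)
  -- the error made by replacing `G` with its Tietze extension
  have herr : ∀ k (hk : X →ᵇ ℝ), (∀ x, ‖hk x‖ ≤ ‖g‖) → (∀ x ∈ F k, hk x = G x) →
      ∀ (ν : Measure X) [IsProbabilityMeasure ν], ν (F k)ᶜ ≤ ENNReal.ofReal (ε k) →
        ‖∫ x, G x ∂ν - ∫ x, hk x ∂ν‖ ≤ 2 * ‖g‖ * ε k := by
    intro k hk hkb hkF ν _ hν
    rw [← integral_sub (hGi ν inferInstance) (hk.integrable ν)]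
    have h1 := norm_integral_le_of_eqOn_zero (ν := ν) (u := fun x ↦ G x - hk x)
      (hF k).measurableSet (fun x hx ↦ by simp [hkF x hx]) (C := 2 * ‖g‖)
      (fun x ↦ (norm_sub_le _ _).trans (by linarith [hGb x, hkb x]))
    have h2 : ν.real (F k)ᶜ ≤ ε k := by
      rw [measureReal_def]
      exact ENNReal.toReal_le_of_le_ofReal (hε0 k) hν
    exact h1.trans (by nlinarith [norm_nonneg g])
  -- the `δ`-argument
  rw [Metric.tendsto_atTop]
  intro δ hδ
  set δ' : ℝ := δ / (8 * ‖g‖ + 8) with hδ'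
  have hδ'0 : 0 < δ' := by positivity
  have hgδ : 4 * ‖g‖ * δ' ≤ δ / 2 := by
    rw [hδ', mul_div_assoc', div_le_div_iff₀ (by positivity) (by norm_num)]
    nlinarith [norm_nonneg g, hδ.le]
  obtain ⟨k, hk⟩ : ∃ k, ε k < δ' := by
    have := (tendsto_order.1 hε).2 δ' hδ'0
    exact this.exists
  obtain ⟨hk', hkb, hkF⟩ := hext k
  have hmid : ∀ᶠ n in atTop, dist (∫ x, hk' x ∂(P n : Measure X)) (∫ x, hk' x ∂(μ : Measure X)) < δ / 2 :=
    (Metric.tendsto_nhds.1 (ProbabilityMeasure.tendsto_iff_forall_integral_tendsto.1 hP hk')) _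
      (half_pos hδ)
  have hμk : (μ : Measure X) (F k)ᶜ ≤ ENNReal.ofReal (ε k) :=
    measure_compl_le_of_tendsto_of_isClosed hP (hF k) (h k)
  obtain ⟨N, hN⟩ := eventually_atTop.1 ((h k).and hmid)
  refine ⟨N, fun n hn ↦ ?_⟩
  obtain ⟨hPn, hmidn⟩ := hN n hn
  have e1 := herr k hk' hkb hkF (P n : Measure X) hPn
  have e2 := herr k hk' hkb hkF (μ : Measure X) hμk
  rw [dist_eq_norm] at hmidn ⊢
  have htri : ‖∫ x, G x ∂(P n : Measure X) - ∫ x, G x ∂(μ : Measure X)‖ ≤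
      ‖∫ x, G x ∂(P n : Measure X) - ∫ x, hk' x ∂(P n : Measure X)‖ +
        ‖∫ x, hk' x ∂(P n : Measure X) - ∫ x, hk' x ∂(μ : Measure X)‖ +
        ‖∫ x, G x ∂(μ : Measure X) - ∫ x, hk' x ∂(μ : Measure X)‖ := by
    have := norm_add₃_le (a := ∫ x, G x ∂(P n : Measure X) - ∫ x, hk' x ∂(P n : Measure X))
      (b := ∫ x, hk' x ∂(P n : Measure X) - ∫ x, hk' x ∂(μ : Measure X))
      (c := ∫ x, hk' x ∂(μ : Measure X) - ∫ x, G x ∂(μ : Measure X))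
    rw [norm_sub_rev (∫ x, hk' x ∂(μ : Measure X))] at this
    refine le_trans (le_of_eq ?_) this
    congr 1
    ring
  have hk4 : 2 * ‖g‖ * ε k + 2 * ‖g‖ * ε k ≤ δ / 2 := by
    nlinarith [norm_nonneg g, hk.le, hε0 k]
  linarith

end Literature.Probability.RandomPlanarGeometry
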